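import Summits.CriticalPhenomena.SAWScalingLimit.Theorems.LeftRightFKG.Negative.BoxDomain
import Literature.Probability.Percolation.FourArmGarbanSquareDomain
import HarnessLib

/-!
# Negative knowledge on crux `LeftRightFKG`, part 4: the discrete domain of the box

**`meshDomain_Ωb`** (the largest mesh component is the whole box, by connectedness) and
**`dAdj_iff`**: adjacency in `Ω_1 = discreteDomainGraph Ωb 1` is lattice adjacency inside the box;
`support_subset_box`. [folklore]
-/

noncomputable section

open Real Set Complex Literature.Probability.LatticeModels Literature.Probability.RandomPlanarGeometry
  Literature.Topology.PlaneTopology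

namespace Summit.CriticalPhenomena.SAWScalingLimit.Theorems.LeftRightFKG.Negative

section BoxMesh

/-! ### The mesh graph and the discrete domain of `Ω` -/

/-- Box sites lie in the open rectangle. [folklore] -/
theorem pt_mem_Rint_of_box {x : Site 2} (hx : x ∈ boxSet) : pt x ∈ Rint := by
  obtain ⟨⟨h1, h2⟩, h3, h4⟩ := hx
  simp only [Rint, mem_setOf_eq, pt_re, pt_im]
  have i1 : (0 : ℝ) ≤ x 0 := by exact_mod_cast h1
  have i2 : (x 0 : ℝ) ≤ 4 := by exact_mod_cast h2
  have i3 : (0 : ℝ) ≤ x 1 := by exact_mod_cast h3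
  have i4 : (x 1 : ℝ) ≤ 3 := by exact_mod_cast h4
  exact ⟨⟨by linarith, by linarith⟩, by linarith, by linarith⟩

/-- Lattice neighbours inside the box are mesh-adjacent. [folklore] -/
theorem meshGraph_adj_of_box {x y : Site 2} (hx : x ∈ boxSet) (hy : y ∈ boxSet)
    (h : (zdGraph 2).Adj x y) : (meshGraph Ωb 1).Adj x y := by
  refine meshGraph_adj_iff.2 ⟨h, ?_⟩
  rw [meshPoint_one, meshPoint_one]
  exact (convex_Rint.segment_subset (pt_mem_Rint_of_box hx) (pt_mem_Rint_of_box hy)).trans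
    (Rint_subset_Ωb.trans subset_closure)

/-- `bx_mem_boxSet` (auxiliary). [folklore] -/
theorem bx_mem_boxSet {i j : ℤ} (h : (0 ≤ i ∧ i ≤ 4) ∧ (0 ≤ j ∧ j ≤ 3)) : bx i j ∈ boxSet := h

/-- **The mesh graph of the box is connected.** [folklore] -/
theorem meshVertexGraph_Ωb_preconnected : (meshVertexGraph Ωb 1).Preconnected := by
  have hV := meshVertices_Ωb
  set G := meshVertexGraph Ωb 1 with hG
  have h00 : bx 0 0 ∈ meshVertices Ωb 1 := by rw [hV]; exact bx_mem_boxSet (by norm_num)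
  have hrow : ∀ k : ℕ, k ≤ 4 →
      ∃ h : bx k 0 ∈ meshVertices Ωb 1, G.Reachable ⟨bx 0 0, h00⟩ ⟨bx k 0, h⟩ := by
    intro k hk
    induction k with
    | zero => exact ⟨by exact_mod_cast h00, by exact_mod_cast SimpleGraph.Reachable.refl _⟩
    | succ k ih =>
      obtain ⟨hk', hr⟩ := ih (Nat.le_of_succ_le hk)
      have hmem : bx (k + 1 : ℕ) 0 ∈ meshVertices Ωb 1 := by
        rw [hV]; exact bx_mem_boxSet ⟨⟨by positivity, by exact_mod_cast hk⟩, le_rfl, by norm_num⟩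
      refine ⟨hmem, hr.trans (SimpleGraph.Adj.reachable ?_)⟩
      simp only [hG, SimpleGraph.comap_adj, Function.Embedding.coe_subtype]
      refine meshGraph_adj_of_box (hV ▸ hk') (hV ▸ hmem) (adj_bx _ _ _ _ (Or.inl ⟨by push_cast; ring, rfl⟩))
  have hcol : ∀ (i k : ℕ), i ≤ 4 → k ≤ 3 →
      ∃ h : bx i k ∈ meshVertices Ωb 1, G.Reachable ⟨bx 0 0, h00⟩ ⟨bx i k, h⟩ := by
    intro i k hi hk
    induction k with
    | zero => obtain ⟨h, hr⟩ := hrow i hi; exact ⟨by exact_mod_cast h, by exact_mod_cast hr⟩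
    | succ k ih =>
      obtain ⟨hk', hr⟩ := ih (Nat.le_of_succ_le hk)
      have hmem : bx i (k + 1 : ℕ) ∈ meshVertices Ωb 1 := by
        rw [hV]; exact bx_mem_boxSet ⟨⟨by positivity, by exact_mod_cast hi⟩, by positivity, by exact_mod_cast hk⟩
      refine ⟨hmem, hr.trans (SimpleGraph.Adj.reachable ?_)⟩
      simp only [hG, SimpleGraph.comap_adj, Function.Embedding.coe_subtype]
      refine meshGraph_adj_of_box (hV ▸ hk') (hV ▸ hmem) (adj_bx _ _ _ _ (Or.inr (Or.inr (Or.inl ⟨by push_cast; ring, rfl⟩))))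
  have hreach : ∀ v : meshVertices Ωb 1, G.Reachable ⟨bx 0 0, h00⟩ v := by
    rintro ⟨v, hv⟩
    have hv' := hv
    rw [hV] at hv'
    obtain ⟨⟨h1, h2⟩, h3, h4⟩ := hv'
    obtain ⟨i, hi⟩ : ∃ i : ℕ, (i : ℤ) = v 0 := ⟨(v 0).toNat, Int.toNat_of_nonneg h1⟩
    obtain ⟨k, hk⟩ : ∃ k : ℕ, (k : ℤ) = v 1 := ⟨(v 1).toNat, Int.toNat_of_nonneg h3⟩
    have hiL : i ≤ 4 := by omega
    have hkL : k ≤ 3 := by omega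
    obtain ⟨h, hr⟩ := hcol i k hiL hkL
    have heq : bx i k = v := by rw [eq_bx v, ← hi, ← hk]
    have hsub : (⟨v, hv⟩ : meshVertices Ωb 1) = ⟨bx i k, h⟩ := Subtype.ext heq.symm
    rw [hsub]
    exact hr
  exact fun u v => (hreach u).symm.trans (hreach v)

/-- **The discrete domain of `Ω` is the whole box.** [folklore] -/
theorem meshDomain_Ωb : meshDomain Ωb 1 = boxSet := by
  rw [Literature.Probability.Percolation.meshDomain_eq_meshVertices_of_preconnected
    meshVertexGraph_Ωb_preconnected, meshVertices_Ωb]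

/-- **Adjacency in `Ω_1`** is lattice adjacency inside the box. [folklore] -/
theorem dAdj_iff {x y : Site 2} :
    (discreteDomainGraph Ωb 1).Adj x y ↔ (zdGraph 2).Adj x y ∧ x ∈ boxSet ∧ y ∈ boxSet := by
  rw [discreteDomainGraph_adj_iff, meshDomain_Ωb]
  constructor
  · rintro ⟨h, hx, hy⟩
    exact ⟨meshGraph_le_zdGraph _ _ h, hx, hy⟩
  · rintro ⟨h, hx, hy⟩
    exact ⟨meshGraph_adj_of_box hx hy h, hx, hy⟩

/-- `dAdj_zd` (auxiliary). [folklore] -/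
theorem dAdj_zd {x y : Site 2} (h : (discreteDomainGraph Ωb 1).Adj x y) : (zdGraph 2).Adj x y :=
  (dAdj_iff.1 h).1

/-- Explicit edges of `Ω_1`. [folklore] -/
theorem dadj (i j i' j' : ℤ) (h : (i' = i + 1 ∧ j' = j) ∨ (i = i' + 1 ∧ j' = j) ∨
    (j' = j + 1 ∧ i' = i) ∨ (j = j' + 1 ∧ i' = i)) (hb : (0 ≤ i ∧ i ≤ 4) ∧ (0 ≤ j ∧ j ≤ 3))
    (hb' : (0 ≤ i' ∧ i' ≤ 4) ∧ (0 ≤ j' ∧ j' ≤ 3)) :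
    (discreteDomainGraph Ωb 1).Adj (bx i j) (bx i' j') :=
  dAdj_iff.2 ⟨adj_bx i j i' j' h, hb, hb'⟩

/-- Walks of `Ω_1` from a box site stay in the box. [folklore] -/
theorem support_subset_box : ∀ {u v : Site 2} (w : (discreteDomainGraph Ωb 1).Walk u v),
    u ∈ boxSet → ∀ x ∈ w.support, x ∈ boxSet
  | _, _, SimpleGraph.Walk.nil, hu, x, hx => by
    rw [SimpleGraph.Walk.support_nil, List.mem_singleton] at hx; exact hx ▸ hu
  | _, _, SimpleGraph.Walk.cons h p, hu, x, hx => by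
    rw [SimpleGraph.Walk.support_cons, List.mem_cons] at hx
    rcases hx with rfl | hx
    · exact hu
    · exact support_subset_box p (dAdj_iff.1 h).2.2 x hx

end BoxMesh

end Summit.CriticalPhenomena.SAWScalingLimit.Theorems.LeftRightFKG.Negative
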